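import Summits.Ventures.LatticeQCDFlow.Scaling.BooleanStarDisagreementDrift

/-!
HONEST FRAMING: exact (Metropolis-corrected) sampling algorithms for lattice gauge theory; figures
of merit are autocorrelation/cost numbers at stated couplings and volumes; no continuum-physics
claim.

# BooleanStarAveragedDrift — THE DRIFT OF THE DISAGREEMENT POTENTIAL WITH THE PAIR'S OWN ACCEPTANCE, AND THE AVERAGED
# ACCEPTANCE UNDER HUB DOMINATION `p·μ_k ≤ μ_0`: AFTER A COMMON REDRAW THE HEALING ENTRY OF A COLD DISAGREEMENT IS ACCEPTED WITH
# MEAN PROBABILITY `≥ p`, WHATEVER THE TWO-POINT LAWS (lean-2 GEN-30, ours)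

Venture-side (OURS).  Cell `lqcd-flow` (pub-lqcd), unit `pub-lqcd-lean-2-g30`, 2026-08-28.  Chapter P (OPEN-MATH-chapterM item 1 on
the two-point family), file 11.  Setting of `Scaling/BooleanStarCoupling` ∕ `…DisagreementPotential` ∕ `…DisagreementDrift` (two-point
replicas, identity entry maps on the hub list `κ` with multiplicities `≥ c`, exact hot redraws, row-stochastic cold kernels, synchronous
coupling `Q`, potential `Φ(x,y) = θ·𝟙{x_0 ≠ y_0} + #{cold disagreements}`).

Files 3–4 contract `Φ` at the rate `(1−θ)·a·ct/m` where `a` is a floor for the acceptance of an entry swap between unequal contents —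
a quantity of the laws that one-sided domination does not control (`a → 0` as `μ_k(s)/μ_0(s) → 0` at fixed domination constant).  This
file and the next remove `a`.  Under HUB DOMINATION `p·μ_k(s) ≤ μ_0(s)` (all cold `k`, both `s`; the two-point identity-map reading of
chapter M's one-sided transported domination) the acceptance of the entry at a configuration with hub content `v` is `≥ p·μ_k(v)/μ_0(v)`
(`accept_ge_dom`), so that AFTER A COMMON REDRAW the mean acceptance of the healing entry of a cold disagreement is
`Σ_v μ_0(v)·min{α_r(x^{0↦v}), α_r(y^{0↦v})} ≥ p·Σ_v μ_k(v) = p` (`sum_redraw_min_accept_ge`).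

## What is proved

* §9 `syncSwap_potential_le_min` — the entry table of file 2 with the pair's own acceptance `min{α_r(x), α_r(y)}` in place of the
  floor `a`; **`boolSync_step_potential_le_gain`** — `Σ_b Q(a,b)Φ(b) ≤ Φ(a) − G(a)` with the exact entry gain
  `G = (1−θ)(t/m)·Σ_r min{α_r(x),α_r(y)}·𝟙{x_{κ_r+1} ≠ y_{κ_r+1}}` if the hubs agree and `G = (1−t)w_0θ − (1−θ)t` if they differ;
  **`accept_ge_dom`**, **`sum_redraw_min_accept_ge`** (the averaged acceptance `≥ p`); `boolSync_gain_nonneg`.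

NOT CLAIMED here: the two-step contraction (file 11b `Scaling/BooleanStarTwoStepContraction`) and the law (file 12).  Literature grade
(cell rule): OWN; nothing cited; no new bib keys.
-/
noncomputable section

open Finset Function
open Literature.Probability.MarkovChains

namespace Summit.Ventures.LatticeQCDFlow.Scaling

variable {K m : ℕ} {μ : Fin (K + 1) → Bool → ℝ} {M : Fin (K + 1) → Bool → Bool → ℝ} {w : Fin (K + 1) → ℝ} {t : ℝ}

section AvgDrift
variable (κ : Fin m → Fin K)

/-! ## §9 The drift with the pair's own acceptance; the averaged acceptance under hub domination -/

/-- **The entry bound with the pair's own acceptance:** for every pair `(x,y)` and entry `r` (`l = κ_r+1`, `0 ≤ θ ≤ 1`, `μ > 0`),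
`min{α_x,α_y}·Φ(y_r x, y_r y) + (α_x − min)·Φ(y_r x, y) + (α_y − min)·Φ(x, y_r y) + (1 − α_x − α_y + min)·Φ(x,y)`
`≤ Φ(x,y) − (1−θ)·min{α_r(x),α_r(y)}·𝟙{x_l ≠ y_l}` if `x_0 = y_0`, and `≤ Φ(x,y) + (1−θ)·𝟙{x_l = y_l}` if `x_0 ≠ y_0` (the table
`swapBracket_le` of file 2 read with the floor `a := min{α_r(x), α_r(y)}`, which is below both acceptances). [ours] -/
theorem syncSwap_potential_le_min (hμ : ∀ k x, 0 < μ k x) {θ : ℝ} (hθ0 : 0 ≤ θ) (hθ1 : θ ≤ 1)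
    {α : Fin m → (Fin (K + 1) → Bool) → ℝ}
    (hα : ∀ r z, α r z = min 1 (tensorFun μ (edgeFlowSwap (Equiv.refl Bool) 0 (κ r).succ z) / tensorFun μ z))
    {Φ : (Fin (K + 1) → Bool) × (Fin (K + 1) → Bool) → ℝ}
    (hΦ : ∀ a, Φ a = ∑ k : Fin (K + 1), (if k = 0 then θ else 1) * (if a.1 k = a.2 k then (0 : ℝ) else 1))
    (r : Fin m) (x y : Fin (K + 1) → Bool) :
    min (α r x) (α r y) * Φ (edgeFlowSwap (Equiv.refl Bool) 0 (κ r).succ x, edgeFlowSwap (Equiv.refl Bool) 0 (κ r).succ y)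
      + (α r x - min (α r x) (α r y)) * Φ (edgeFlowSwap (Equiv.refl Bool) 0 (κ r).succ x, y)
      + (α r y - min (α r x) (α r y)) * Φ (x, edgeFlowSwap (Equiv.refl Bool) 0 (κ r).succ y)
      + (1 - α r x - α r y + min (α r x) (α r y)) * Φ (x, y)
    ≤ Φ (x, y) + (if x 0 = y 0 then -((1 - θ) * min (α r x) (α r y) * (if x (κ r).succ = y (κ r).succ then (0 : ℝ) else 1))
        else (1 - θ) * (if x (κ r).succ = y (κ r).succ then (1 : ℝ) else 0)) := by
  have hl : (0 : Fin (K + 1)) ≠ (κ r).succ := (Fin.succ_ne_zero (κ r)).symm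
  have hacc := accept_mem κ (fun _ : Fin m => Equiv.refl Bool) hμ hα r
  set yx := edgeFlowSwap (Equiv.refl Bool) 0 (κ r).succ x with hyx
  set yy := edgeFlowSwap (Equiv.refl Bool) 0 (κ r).succ y with hyy
  have hyx0 : yx 0 = x (κ r).succ := by rw [hyx, boolSwap_apply, if_pos rfl]
  have hyxl : yx (κ r).succ = x 0 := by rw [hyx, boolSwap_apply, if_neg hl.symm, if_pos rfl]
  have hyy0 : yy 0 = y (κ r).succ := by rw [hyy, boolSwap_apply, if_pos rfl]
  have hyyl : yy (κ r).succ = y 0 := by rw [hyy, boolSwap_apply, if_neg hl.symm, if_pos rfl]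
  have hyxk : ∀ k : Fin (K + 1), k ≠ 0 → k ≠ (κ r).succ → yx k = x k := fun k h1 h2 => by
    rw [hyx, boolSwap_apply, if_neg h1, if_neg h2]
  have hyyk : ∀ k : Fin (K + 1), k ≠ 0 → k ≠ (κ r).succ → yy k = y k := fun k h1 h2 => by
    rw [hyy, boolSwap_apply, if_neg h1, if_neg h2]
  set Φ0 := Φ (x, y) - θ * (if x 0 = y 0 then (0 : ℝ) else 1) - (if x (κ r).succ = y (κ r).succ then (0 : ℝ) else 1)
    with hΦ0
  have e1 : Φ (yx, yy) = Φ0 + θ * (if x (κ r).succ = y (κ r).succ then (0 : ℝ) else 1) + (if x 0 = y 0 then (0 : ℝ) else 1) := by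
    have h := potential_local_pair κ hΦ r (x := x) (y := y) (x' := yx) (y' := yy) fun k h1 h2 => ⟨hyxk k h1 h2, hyyk k h1 h2⟩
    rw [hyx0, hyxl, hyy0, hyyl] at h; rw [h, hΦ0]; ring
  have e2 : Φ (yx, y) = Φ0 + θ * (if x (κ r).succ = y 0 then (0 : ℝ) else 1) + (if x 0 = y (κ r).succ then (0 : ℝ) else 1) := by
    have h := potential_local_pair κ hΦ r (x := x) (y := y) (x' := yx) (y' := y) fun k h1 h2 => ⟨hyxk k h1 h2, rfl⟩
    rw [hyx0, hyxl] at h; rw [h, hΦ0]; ring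
  have e3 : Φ (x, yy) = Φ0 + θ * (if x 0 = y (κ r).succ then (0 : ℝ) else 1) + (if x (κ r).succ = y 0 then (0 : ℝ) else 1) := by
    have h := potential_local_pair κ hΦ r (x := x) (y := y) (x' := x) (y' := yy) fun k h1 h2 => ⟨rfl, hyyk k h1 h2⟩
    rw [hyy0, hyyl] at h; rw [h, hΦ0]; ring
  have e4 : Φ (x, y) = Φ0 + θ * (if x 0 = y 0 then (0 : ℝ) else 1) + (if x (κ r).succ = y (κ r).succ then (0 : ℝ) else 1) := by
    rw [hΦ0]; ring
  -- the floor `min{α_x, α_y}` is below both acceptances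
  have hax : min (α r x) (α r y) * (if x 0 = x (κ r).succ then (0 : ℝ) else 1)
      ≤ α r x * (if x 0 = x (κ r).succ then (0 : ℝ) else 1) :=
    mul_le_mul_of_nonneg_right (min_le_left _ _) (by split_ifs <;> norm_num)
  have hay : min (α r x) (α r y) * (if y 0 = y (κ r).succ then (0 : ℝ) else 1)
      ≤ α r y * (if y 0 = y (κ r).succ then (0 : ℝ) else 1) :=
    mul_le_mul_of_nonneg_right (min_le_right _ _) (by split_ifs <;> norm_num)
  have hβ : (α r x - min (α r x) (α r y)) * (if x 0 = y 0 then (1 : ℝ) else 0) * (if x (κ r).succ = y (κ r).succ then (1 : ℝ) else 0) = 0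
      ∧ (α r y - min (α r x) (α r y)) * (if x 0 = y 0 then (1 : ℝ) else 0)
        * (if x (κ r).succ = y (κ r).succ then (1 : ℝ) else 0) = 0 := by
    by_cases h0 : x 0 = y 0
    · by_cases hl' : x (κ r).succ = y (κ r).succ
      · have := accept_eq_of_agree κ hμ hα r h0 hl'
        rw [this, min_self, sub_self, zero_mul, zero_mul]; exact ⟨rfl, rfl⟩
      · rw [if_neg hl', mul_zero, mul_zero]; exact ⟨rfl, rfl⟩
    · rw [if_neg h0, mul_zero, zero_mul, mul_zero, zero_mul]; exact ⟨rfl, rfl⟩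
  rw [e1, e2, e3, e4]
  have key := swapBracket_le (x 0) (x (κ r).succ) (y 0) (y (κ r).succ) (Φ0 := Φ0) hθ0 hθ1 (hacc x).2 (hacc y).2
    (min_le_left (α r x) (α r y)) (min_le_right (α r x) (α r y)) hax hay hβ
  convert key using 2

/-- **THE DRIFT WITH THE EXACT ENTRY GAIN:** Boolean star, synchronous coupling `Q`, potential `Φ` (`0 ≤ θ ≤ 1`):
**`Σ_b Q(a,b)Φ(b) ≤ Φ(a) − G(a)`** where `G(x,y) = (1−θ)·(t/m)·Σ_r min{α_r(x),α_r(y)}·𝟙{x_{κ_r+1} ≠ y_{κ_r+1}}` if `x_0 = y_0` and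
`G(x,y) = (1−t)w_0·θ − (1−θ)·t` if `x_0 ≠ y_0` (no floor, no regime: the second value may be negative). [ours] -/
theorem boolSync_step_potential_le_gain (hm : 1 ≤ m) (ht0 : 0 ≤ t) (ht1 : t ≤ 1) (hw0 : ∀ k, 0 ≤ w k) (hw1 : ∑ k, w k = 1)
    (hμ : ∀ k x, 0 < μ k x) (hM : ∀ k, IsRowStochastic (M k)) {θ : ℝ} (hθ0 : 0 ≤ θ) (hθ1 : θ ≤ 1)
    {α : Fin m → (Fin (K + 1) → Bool) → ℝ}
    (hα : ∀ r z, α r z = min 1 (tensorFun μ (edgeFlowSwap (Equiv.refl Bool) 0 (κ r).succ z) / tensorFun μ z))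
    {Φ : (Fin (K + 1) → Bool) × (Fin (K + 1) → Bool) → ℝ}
    (hΦ : ∀ a, Φ a = ∑ k : Fin (K + 1), (if k = 0 then θ else 1) * (if a.1 k = a.2 k then (0 : ℝ) else 1))
    {G : (Fin (K + 1) → Bool) × (Fin (K + 1) → Bool) → ℝ}
    (hG : ∀ a, G a = if a.1 0 = a.2 0
      then (1 - θ) * (t / m) * ∑ r : Fin m, min (α r a.1) (α r a.2) * (if a.1 (κ r).succ = a.2 (κ r).succ then (0 : ℝ) else 1)
      else (1 - t) * w 0 * θ - (1 - θ) * t)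
    {Q : (Fin (K + 1) → Bool) × (Fin (K + 1) → Bool) → (Fin (K + 1) → Bool) × (Fin (K + 1) → Bool) → ℝ}
    (hQ : ∀ a b, Q a b =
      ∑ r : Fin m, t / m *
        (min (α r a.1) (α r a.2) * (if b.1 = edgeFlowSwap (Equiv.refl Bool) 0 (κ r).succ a.1
              ∧ b.2 = edgeFlowSwap (Equiv.refl Bool) 0 (κ r).succ a.2 then (1 : ℝ) else 0)
          + (α r a.1 - min (α r a.1) (α r a.2)) * (if b.1 = edgeFlowSwap (Equiv.refl Bool) 0 (κ r).succ a.1 ∧ b.2 = a.2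
              then (1 : ℝ) else 0)
          + (α r a.2 - min (α r a.1) (α r a.2)) * (if b.1 = a.1 ∧ b.2 = edgeFlowSwap (Equiv.refl Bool) 0 (κ r).succ a.2
              then (1 : ℝ) else 0)
          + (1 - α r a.1 - α r a.2 + min (α r a.1) (α r a.2)) * (if b.1 = a.1 ∧ b.2 = a.2 then (1 : ℝ) else 0))
      + (1 - t) * ∑ k : Fin (K + 1), w k *
        (if a.1 k = a.2 k ∨ k = 0 then
            ∑ v : Bool, M k (a.1 k) v * (if b.1 = update a.1 k v ∧ b.2 = update a.2 k v then (1 : ℝ) else 0)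
          else coordKernel M k a.1 b.1 * coordKernel M k a.2 b.2))
    (a' : (Fin (K + 1) → Bool) × (Fin (K + 1) → Bool)) :
    ∑ b, Q a' b * Φ b ≤ Φ a' - G a' := by
  obtain ⟨x, y⟩ := a'
  have hmpos : (0 : ℝ) < m := Nat.cast_pos.mpr (by omega)
  set Sw : Fin m → ℝ := fun r =>
      min (α r x) (α r y) * Φ (edgeFlowSwap (Equiv.refl Bool) 0 (κ r).succ x, edgeFlowSwap (Equiv.refl Bool) 0 (κ r).succ y)
        + (α r x - min (α r x) (α r y)) * Φ (edgeFlowSwap (Equiv.refl Bool) 0 (κ r).succ x, y)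
        + (α r y - min (α r x) (α r y)) * Φ (x, edgeFlowSwap (Equiv.refl Bool) 0 (κ r).succ y)
        + (1 - α r x - α r y + min (α r x) (α r y)) * Φ (x, y) with hSw
  set Up : Fin (K + 1) → ℝ := fun k => ∑ b : (Fin (K + 1) → Bool) × (Fin (K + 1) → Bool),
      (if x k = y k ∨ k = 0 then
          ∑ v : Bool, M k (x k) v * (if b.1 = update x k v ∧ b.2 = update y k v then (1 : ℝ) else 0)
        else coordKernel M k x b.1 * coordKernel M k y b.2) * Φ b with hUp
  have hexp : ∑ b, Q (x, y) b * Φ b = ∑ r : Fin m, t / m * Sw r + ∑ k : Fin (K + 1), ((1 - t) * w k) * Up k := by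
    have hsplit : ∑ b, Q (x, y) b * Φ b
        = ∑ b : (Fin (K + 1) → Bool) × (Fin (K + 1) → Bool), (∑ r : Fin m, t / m *
            (min (α r x) (α r y) * (if b.1 = edgeFlowSwap (Equiv.refl Bool) 0 (κ r).succ x
                  ∧ b.2 = edgeFlowSwap (Equiv.refl Bool) 0 (κ r).succ y then (1 : ℝ) else 0)
              + (α r x - min (α r x) (α r y)) * (if b.1 = edgeFlowSwap (Equiv.refl Bool) 0 (κ r).succ x ∧ b.2 = y
                  then (1 : ℝ) else 0)
              + (α r y - min (α r x) (α r y)) * (if b.1 = x ∧ b.2 = edgeFlowSwap (Equiv.refl Bool) 0 (κ r).succ y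
                  then (1 : ℝ) else 0)
              + (1 - α r x - α r y + min (α r x) (α r y)) * (if b.1 = x ∧ b.2 = y then (1 : ℝ) else 0))) * Φ b
          + ∑ b : (Fin (K + 1) → Bool) × (Fin (K + 1) → Bool), (∑ k : Fin (K + 1), ((1 - t) * w k) *
            (if x k = y k ∨ k = 0 then
                ∑ v : Bool, M k (x k) v * (if b.1 = update x k v ∧ b.2 = update y k v then (1 : ℝ) else 0)
              else coordKernel M k x b.1 * coordKernel M k y b.2)) * Φ b := by
      rw [← Finset.sum_add_distrib]
      refine sum_congr rfl fun b _ => ?_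
      rw [hQ, ← add_mul]
      congr 2
      rw [Finset.mul_sum]
      exact sum_congr rfl fun k _ => by ring
    rw [hsplit, sum_mixture_mul, sum_mixture_mul]
    congr 1
    exact sum_congr rfl fun r _ => by rw [syncSwap_sum_potential]
  rw [hexp]
  have hswap : ∀ r : Fin m, Sw r ≤ Φ (x, y) + (if x 0 = y 0
      then -((1 - θ) * min (α r x) (α r y) * (if x (κ r).succ = y (κ r).succ then (0 : ℝ) else 1))
      else (1 - θ) * (if x (κ r).succ = y (κ r).succ then (1 : ℝ) else 0)) :=
    fun r => syncSwap_potential_le_min κ hμ hθ0 hθ1 hα hΦ r x y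
  have hupd : ∀ k : Fin (K + 1), Up k ≤ Φ (x, y) - (if k = 0 then θ * (if x 0 = y 0 then (0 : ℝ) else 1) else 0) :=
    fun k => syncUpdate_sum_potential_le hM hΦ k x y
  have h2 : ∑ k : Fin (K + 1), ((1 - t) * w k) * Up k
      ≤ (1 - t) * Φ (x, y) - (1 - t) * w 0 * θ * (if x 0 = y 0 then (0 : ℝ) else 1) := by
    calc ∑ k : Fin (K + 1), ((1 - t) * w k) * Up k
        ≤ ∑ k : Fin (K + 1), ((1 - t) * w k) * (Φ (x, y) - (if k = 0 then θ * (if x 0 = y 0 then (0 : ℝ) else 1) else 0)) :=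
          sum_le_sum fun k _ => mul_le_mul_of_nonneg_left (hupd k) (mul_nonneg (by linarith) (hw0 k))
      _ = (1 - t) * Φ (x, y) - (1 - t) * w 0 * θ * (if x 0 = y 0 then (0 : ℝ) else 1) := by
          simp_rw [mul_sub, Finset.sum_sub_distrib]
          rw [show ∑ k : Fin (K + 1), (1 - t) * w k * Φ (x, y) = (1 - t) * Φ (x, y) by
            rw [← Finset.sum_mul, ← Finset.mul_sum, hw1, mul_one]]
          rw [Finset.sum_eq_single (0 : Fin (K + 1)) (fun k _ hk => by rw [if_neg hk, mul_zero])
            (fun h => absurd (mem_univ _) h), if_pos rfl]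
          ring
  have htsum : ∑ _r : Fin m, t / m * Φ (x, y) = t * Φ (x, y) := by
    rw [sum_const, card_univ, Fintype.card_fin, nsmul_eq_mul]; field_simp
  rw [hG]
  by_cases h0 : x 0 = y 0
  · -- hubs agree: each listed cold disagreement is healed with the pair's own acceptance
    rw [if_pos h0, mul_zero, sub_zero] at h2
    simp only [h0, if_true]
    have h1 : ∑ r : Fin m, t / m * Sw r
        ≤ t * Φ (x, y) - t / m * (1 - θ)
          * ∑ r : Fin m, min (α r x) (α r y) * (if x (κ r).succ = y (κ r).succ then (0 : ℝ) else 1) := by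
      calc ∑ r : Fin m, t / m * Sw r
          ≤ ∑ r : Fin m, (t / m * Φ (x, y)
              - t / m * (1 - θ) * (min (α r x) (α r y) * (if x (κ r).succ = y (κ r).succ then (0 : ℝ) else 1))) :=
            sum_le_sum fun r _ => by
              have h := hswap r
              rw [if_pos h0] at h
              have := mul_le_mul_of_nonneg_left h (show (0 : ℝ) ≤ t / m by positivity)
              linarith
        _ = t * Φ (x, y) - t / m * (1 - θ)
              * ∑ r : Fin m, min (α r x) (α r y) * (if x (κ r).succ = y (κ r).succ then (0 : ℝ) else 1) := by
            rw [Finset.sum_sub_distrib, htsum, ← Finset.mul_sum]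
    have e : Φ (x, y) - (1 - θ) * (t / m)
          * ∑ r : Fin m, min (α r x) (α r y) * (if x (κ r).succ = y (κ r).succ then (0 : ℝ) else 1)
        = (t * Φ (x, y) - t / m * (1 - θ)
          * ∑ r : Fin m, min (α r x) (α r y) * (if x (κ r).succ = y (κ r).succ then (0 : ℝ) else 1))
          + (1 - t) * Φ (x, y) := by ring
    rw [e]; exact add_le_add h1 h2
  · -- hubs differ: the hub disagreement escapes at rate `≤ t`, dies at rate `(1−t)w_0`
    rw [if_neg h0, mul_one] at h2
    simp only [h0, if_false]
    have h1 : ∑ r : Fin m, t / m * Sw r ≤ t * Φ (x, y) + t * (1 - θ) := by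
      calc ∑ r : Fin m, t / m * Sw r ≤ ∑ _r : Fin m, (t / m * Φ (x, y) + t / m * (1 - θ)) :=
            sum_le_sum fun r _ => by
              have h := hswap r
              rw [if_neg h0] at h
              have hb : (1 - θ) * (if x (κ r).succ = y (κ r).succ then (1 : ℝ) else 0) ≤ 1 - θ := by
                split_ifs
                · rw [mul_one]
                · rw [mul_zero]; linarith
              have := mul_le_mul_of_nonneg_left (h.trans (by linarith [hb] : Φ (x, y) + (1 - θ)
                * (if x (κ r).succ = y (κ r).succ then (1 : ℝ) else 0) ≤ Φ (x, y) + (1 - θ)))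
                (show (0 : ℝ) ≤ t / m by positivity)
              linarith
        _ = t * Φ (x, y) + t * (1 - θ) := by
            rw [Finset.sum_add_distrib, htsum, sum_const, card_univ, Fintype.card_fin, nsmul_eq_mul]
            field_simp
    linarith [h1, h2]

/-- **Acceptance under hub domination:** if `p·μ_k(s) ≤ μ_0(s)` for every cold level `k` and both contents `s`, then for every entry
`r` (`l = κ_r+1`) and configuration `z`, **`p·μ_l(z_0) ≤ μ_0(z_0)·α_r(z)`** — the entry that would carry the hub content `z_0` to
level `l` is accepted with probability at least `p·μ_l(z_0)/μ_0(z_0)` (`α_r(z)·μ_0(z_0)μ_l(z_l) = min{μ_0(z_0)μ_l(z_l), μ_0(z_l)μ_l(z_0)}`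
and both arguments of the minimum are `≥ p·μ_l(z_0)·μ_l(z_l)`). [ours] -/
theorem accept_ge_dom (hμ : ∀ k x, 0 < μ k x) {α : Fin m → (Fin (K + 1) → Bool) → ℝ}
    (hα : ∀ r z, α r z = min 1 (tensorFun μ (edgeFlowSwap (Equiv.refl Bool) 0 (κ r).succ z) / tensorFun μ z))
    {p : ℝ} (hp : ∀ (j : Fin K) (s : Bool), p * μ j.succ s ≤ μ 0 s) (r : Fin m) (z : Fin (K + 1) → Bool) :
    p * μ (κ r).succ (z 0) ≤ μ 0 (z 0) * α r z := by
  have h := accept_mul_pair κ (fun _ : Fin m => Equiv.refl Bool) hμ hα r z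
  simp only [Equiv.refl_symm, Equiv.refl_apply] at h
  have hl : 0 < μ (κ r).succ (z (κ r).succ) := hμ _ _
  have hl0 : 0 ≤ μ (κ r).succ (z 0) := (hμ _ _).le
  have h1 := hp (κ r) (z 0)
  have h2 := hp (κ r) (z (κ r).succ)
  have key : p * μ (κ r).succ (z 0) * μ (κ r).succ (z (κ r).succ)
      ≤ μ 0 (z 0) * α r z * μ (κ r).succ (z (κ r).succ) := by
    have e : μ 0 (z 0) * α r z * μ (κ r).succ (z (κ r).succ)
        = min (μ 0 (z 0) * μ (κ r).succ (z (κ r).succ)) (μ 0 (z (κ r).succ) * μ (κ r).succ (z 0)) := by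
      rw [← h]; ring
    rw [e]
    refine le_min ?_ ?_
    · exact mul_le_mul_of_nonneg_right h1 hl.le
    · calc p * μ (κ r).succ (z 0) * μ (κ r).succ (z (κ r).succ)
          = p * μ (κ r).succ (z (κ r).succ) * μ (κ r).succ (z 0) := by ring
        _ ≤ μ 0 (z (κ r).succ) * μ (κ r).succ (z 0) := mul_le_mul_of_nonneg_right h2 hl0
  exact le_of_mul_le_mul_right key hl

/-- **The averaged acceptance after a common redraw is `≥ p`:** under hub domination and `Σ_s μ_k(s) = 1`, for every entry `r` and
pair `(x,y)`, **`Σ_v μ_0(v)·min{α_r(x^{0↦v}), α_r(y^{0↦v})} ≥ p`** (`x^{0↦v} = update x 0 v`; by `accept_ge_dom` each term is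
`≥ p·μ_{κ_r+1}(v)`). [ours] -/
theorem sum_redraw_min_accept_ge (hμ : ∀ k x, 0 < μ k x) (hμ1 : ∀ k, ∑ u, μ k u = 1)
    {α : Fin m → (Fin (K + 1) → Bool) → ℝ}
    (hα : ∀ r z, α r z = min 1 (tensorFun μ (edgeFlowSwap (Equiv.refl Bool) 0 (κ r).succ z) / tensorFun μ z))
    {p : ℝ} (hp : ∀ (j : Fin K) (s : Bool), p * μ j.succ s ≤ μ 0 s) (r : Fin m) (x y : Fin (K + 1) → Bool) :
    p ≤ ∑ v : Bool, μ 0 v * min (α r (update x 0 v)) (α r (update y 0 v)) := by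
  calc p = ∑ v : Bool, p * μ (κ r).succ v := by rw [← Finset.mul_sum, hμ1, mul_one]
    _ ≤ ∑ v : Bool, μ 0 v * min (α r (update x 0 v)) (α r (update y 0 v)) := sum_le_sum fun v _ => by
        have hx := accept_ge_dom κ hμ hα hp r (update x 0 v)
        have hy := accept_ge_dom κ hμ hα hp r (update y 0 v)
        rw [update_self] at hx hy
        rcases le_total (α r (update x 0 v)) (α r (update y 0 v)) with h | h
        · rw [min_eq_left h]; exact hx
        · rw [min_eq_right h]; exact hy

/-- The gain is non-negative under the regime-free weight condition `(1−θ)t ≤ (1−t)w_0·θ` (`0 ≤ θ ≤ 1`, `0 ≤ t`, `μ > 0`). [ours] -/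
theorem boolSync_gain_nonneg (hμ : ∀ k x, 0 < μ k x) (ht0 : 0 ≤ t) {θ : ℝ} (hθ1 : θ ≤ 1) (hreg : (1 - θ) * t ≤ (1 - t) * w 0 * θ)
    {α : Fin m → (Fin (K + 1) → Bool) → ℝ}
    (hα : ∀ r z, α r z = min 1 (tensorFun μ (edgeFlowSwap (Equiv.refl Bool) 0 (κ r).succ z) / tensorFun μ z))
    {G : (Fin (K + 1) → Bool) × (Fin (K + 1) → Bool) → ℝ}
    (hG : ∀ a, G a = if a.1 0 = a.2 0
      then (1 - θ) * (t / m) * ∑ r : Fin m, min (α r a.1) (α r a.2) * (if a.1 (κ r).succ = a.2 (κ r).succ then (0 : ℝ) else 1)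
      else (1 - t) * w 0 * θ - (1 - θ) * t)
    (a : (Fin (K + 1) → Bool) × (Fin (K + 1) → Bool)) : 0 ≤ G a := by
  have hacc := accept_mem κ (fun _ : Fin m => Equiv.refl Bool) hμ hα
  rw [hG]
  split_ifs
  · exact mul_nonneg (mul_nonneg (sub_nonneg.mpr hθ1) (div_nonneg ht0 (Nat.cast_nonneg _)))
      (sum_nonneg fun r _ => mul_nonneg (le_min (hacc r _).1 (hacc r _).1) (by split_ifs <;> norm_num))
  · linarith

end AvgDrift

end Summit.Ventures.LatticeQCDFlow.Scaling

end
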